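import Summits.AtomisticToContinuum.HydrodynamicLimit.Theorems.CollisionIsometryCLTMacroClosureTwoScaleDefs
import Summits.AtomisticToContinuum.HydrodynamicLimit.Theorems.CollisionIsometryCLTMacroClosureGaussCellMGF
import Literature.MathematicalPhysics.KineticTheory.HardSphereEulerProofs
import HarnessLib

/-!
# Velocity factorisation of the cell kinetic functionals (input of `stub_blockMGF_twoScale`,
line `IdeatorTwoGen1Sketch`, crux `MacroClosure`, stmt-AtomisticToContinuum-14870)

Proof file (`--supports stmt-AtomisticToContinuum-14870`) for the registered stub `Barycentric.stub_twoScale_velocityFactor`: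
under the product Gaussian velocity law `N(u_c, θ_c id)^{⊗(N+1)}` at fixed positions `q`, for pairwise disjoint cells
`S_k = cellSet ℓ (q, ·) (y_k)` with `#S_k > n₀`, `E ∏_k exp(γ' cellKin_k) ≤ K^{#cells}` with the constants
`(K, n₀)` of the landed Gaussian cell MGF `stub_gaussCellMGF` (`K` replaced by `max K 0`).

* `VelocityFactor.pi_map_reindex` — the finite power `μ^{⊗δ}` of a probability measure pushed forward along the
  reindexing `v ↦ v ∘ f` by an injection `f : β → δ` is `μ^{⊗β}` (Mathlib's `map_infinitePi_infinitePi_of_inj`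
  through `infinitePi_eq_pi`);
* `VelocityFactor.iIndepFun_blocks` — blocks of coordinates `v ↦ (v (f k j))_j` along injections `f k : β k → δ`
  with pairwise disjoint ranges (one injection on `Σ k, β k`) are independent under `μ^{⊗δ}`: by
  `iIndepFun_iff_map_fun_eq_infinitePi_map` it suffices that the joint law is the product of the block laws, which
  is `map_infinitePi_infinitePi_of_inj` on `Σ k, β k` followed by `infinitePi_map_piCurry`;
* `VelocityFactor.lintegral_prod_blocks` — hence `∫ ∏_k F_k(v ∘ f_k) dμ^{⊗δ} = ∏_k ∫ F_k dμ^{⊗β_k}`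
  (`lintegral_prod_eq_prod_lintegral_of_indepFun` and the reindexing);
* the stub: `cellSet ℓ (zipConfig (q, v)) x` does not depend on `v` (definitionally), so with
  `e_k : Fin (m_k + 1) ≃ S_k` (`#S_k = m_k + 1`, `m_k ≥ n₀`) the `k`-th factor is the `stub_gaussCellMGF` integrand
  for `n = m_k` evaluated at `v ∘ e_k` (`Fintype.sum_equiv`, `Finset.sum_coe_sort`), the `e_k` assemble to an
  injection on `Σ k, Fin (m_k + 1)` by disjointness, and each block integral is `≤ K`.
-/

noncomputable section

open MeasureTheory Filter Set Topology InformationTheory ProbabilityTheory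
open scoped ENNReal ContDiff Convolution

namespace Summit.AtomisticToContinuum.HydrodynamicLimit.Theorems.MacroClosureLine

open Literature.MathematicalPhysics.KineticTheory Literature.Analysis.FluidPDE
open Literature.Analysis.FunctionSpaces

namespace Barycentric

namespace VelocityFactor

variable {δ α : Type*} [Fintype δ] [MeasurableSpace α] (μ : Measure α) [IsProbabilityMeasure μ]

/-- Reindexing a finite power of a probability measure along an injection gives the power over
the source index type. [folklore] -/
theorem pi_map_reindex {β : Type*} [Fintype β] (f : β → δ) (hf : Function.Injective f) :
    (Measure.pi fun _ : δ => μ).map (fun v j => v (f j)) = Measure.pi fun _ : β => μ := by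
  rw [← Measure.infinitePi_eq_pi (μ := fun _ : δ => μ),
    ← Measure.infinitePi_eq_pi (μ := fun _ : β => μ)]
  exact Measure.map_infinitePi_infinitePi_of_inj hf

/-- Under a finite power of a probability measure, the blocks of coordinates along injections
with pairwise disjoint ranges (one injection on the total index type `Σ k, β k`) are
independent: the joint law of the blocks is the curried product measure. [folklore] -/
theorem iIndepFun_blocks {ι : Type*} {β : ι → Type*} (f : ∀ k, β k → δ)
    (hf : Function.Injective fun p : (Σ k, β k) => f p.1 p.2) :
    iIndepFun (fun k (v : δ → α) (j : β k) => v (f k j)) (Measure.pi fun _ : δ => μ) := by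
  have hfk : ∀ k, Function.Injective (f k) := fun k j j' h =>
    sigma_mk_injective (hf (a₁ := ⟨k, j⟩) (a₂ := ⟨k, j'⟩) h)
  rw [iIndepFun_iff_map_fun_eq_infinitePi_map (fun k => by fun_prop),
    ← Measure.infinitePi_eq_pi (μ := fun _ : δ => μ)]
  have h1 : (fun (v : δ → α) k (j : β k) => v (f k j)) =
      (MeasurableEquiv.piCurry fun k (_ : β k) => α) ∘
        (fun v (p : Σ k, β k) => v (f p.1 p.2)) := by
    funext v k j; rfl
  rw [h1, ← Measure.map_map (MeasurableEquiv.measurable _) (by fun_prop),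
    Measure.map_infinitePi_infinitePi_of_inj hf,
    Measure.infinitePi_map_piCurry (fun k (_ : β k) => μ)]
  congr 1
  funext k
  exact (Measure.map_infinitePi_infinitePi_of_inj (P := fun _ : δ => μ) (hfk k)).symm

/-- **Factorisation of a product of block functions** under a finite power of a probability
measure: if the blocks are reindexed along injections with pairwise disjoint ranges, the
integral of the product is the product of the block integrals, each computed under the power
over its own index type. [folklore] -/
theorem lintegral_prod_blocks {ι : Type*} [Fintype ι] {β : ι → Type*} [∀ k, Fintype (β k)]
    (f : ∀ k, β k → δ) (hf : Function.Injective fun p : (Σ k, β k) => f p.1 p.2)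
    (F : ∀ k, (β k → α) → ℝ≥0∞) (hF : ∀ k, Measurable (F k)) :
    ∫⁻ v, ∏ k, F k (fun j => v (f k j)) ∂(Measure.pi fun _ : δ => μ) =
      ∏ k, ∫⁻ w, F k w ∂(Measure.pi fun _ : β k => μ) := by
  have hfk : ∀ k, Function.Injective (f k) := fun k j j' h =>
    sigma_mk_injective (hf (a₁ := ⟨k, j⟩) (a₂ := ⟨k, j'⟩) h)
  have hind : iIndepFun (fun k (v : δ → α) => F k (fun j => v (f k j)))
      (Measure.pi fun _ : δ => μ) := (iIndepFun_blocks μ f hf).comp F hF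
  rw [lintegral_prod_eq_prod_lintegral_of_indepFun Finset.univ
    (fun k (v : δ → α) => F k (fun j => v (f k j))) hind (fun k => (hF k).comp (by fun_prop))]
  refine Finset.prod_congr rfl fun k _ => ?_
  rw [← pi_map_reindex μ (f k) (hfk k), lintegral_map (hF k) (by fun_prop)]

end VelocityFactor

/-- **Velocity factorisation** (registered stub `stub_twoScale_velocityFactor`): for a tilt
`0 < γ' < 1` there are `K ≥ 0` and `n₀` such that, for i.i.d. `N(u_c, θ_c id)` velocities
attached to fixed positions `q`, any finite family of cubes whose index sets are pairwise
disjoint and each contain more than `n₀` particles has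
`E ∏_k exp(γ' · cellKin_k) ≤ K ^ #cells`. The cells only depend on the positions, so the
`k`-th factor is a function of the velocities indexed by the `k`-th cell; these blocks are
independent under the product Gaussian (`VelocityFactor.lintegral_prod_blocks`), and each
block integral is the `(n+1)`-particle Gaussian cell MGF bounded by the landed
`stub_gaussCellMGF`. [folklore] -/
theorem stub_twoScale_velocityFactor : ∀ γ' : ℝ, 0 < γ' → γ' < 1 → ∃ (K : ℝ) (n₀ : ℕ), 0 ≤ K ∧
    ∀ (ι : Type) [Fintype ι] (N : ℕ) (uc : V3) (θc : ℝ), 0 < θc → ∀ (ℓ : ℝ) (y : ι → T3) (q : Fin (N + 1) → T3),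
    (∀ k k', k ≠ k' → Disjoint (cellSet ℓ (zipConfig (q, fun _ => (0 : V3))) (y k))
      (cellSet ℓ (zipConfig (q, fun _ => (0 : V3))) (y k'))) →
    (∀ k, n₀ < cellCount ℓ (zipConfig (q, fun _ => (0 : V3))) (y k)) →
    ∫⁻ v, ∏ k, ENNReal.ofReal (Real.exp (γ' * cellKin uc θc ℓ (zipConfig (q, v)) (y k)))
        ∂(Measure.pi fun _ : Fin (N + 1) => gaussMeasure uc θc) ≤ ENNReal.ofReal K ^ Fintype.card ι := by
  intro γ' hγ0 hγ1
  obtain ⟨K', n₀, hK'⟩ := stub_gaussCellMGF γ' hγ0 hγ1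
  refine ⟨max K' 0, n₀, le_max_right _ _, ?_⟩
  intro ι _ N uc θc hθc ℓ y q hdisj hcount
  -- the cells only depend on the positions
  set z₀ : Config (N + 1) (Fin 3) T3 := zipConfig (q, fun _ => (0 : V3)) with hz₀
  have hcell : ∀ (v : Fin (N + 1) → V3) (x : T3), cellSet ℓ (zipConfig (q, v)) x = cellSet ℓ z₀ x :=
    fun v x => rfl
  have hcnt : ∀ (v : Fin (N + 1) → V3) (x : T3),
      cellCount ℓ (zipConfig (q, v)) x = cellCount ℓ z₀ x := fun v x => rfl
  -- cell sizes `#S_k = m_k + 1`, `m_k ≥ n₀`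
  obtain ⟨m, hm⟩ : ∃ m : ι → ℕ, ∀ k, cellCount ℓ z₀ (y k) = m k + 1 ∧ n₀ ≤ m k :=
    ⟨fun k => cellCount ℓ z₀ (y k) - 1, fun k => by have := hcount k; dsimp only; omega⟩
  have hcard : ∀ k, Fintype.card ↥(cellSet ℓ z₀ (y k)) = m k + 1 := fun k => by
    rw [Fintype.card_coe]; exact (hm k).1
  -- enumerations of the cells
  set e : ∀ k, Fin (m k + 1) ≃ ↥(cellSet ℓ z₀ (y k)) := fun k =>
    (Fintype.equivFinOfCardEq (hcard k)).symm with he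
  have hf : Function.Injective fun p : (Σ k, Fin (m k + 1)) =>
      ((e p.1 p.2 : ↥(cellSet ℓ z₀ (y p.1))) : Fin (N + 1)) := by
    rintro ⟨k, j⟩ ⟨k', j'⟩ h
    dsimp only at h
    have hk : k = k' := by
      by_contra hkk
      have h1 : ((e k j : ↥(cellSet ℓ z₀ (y k))) : Fin (N + 1)) ∈ cellSet ℓ z₀ (y k) := (e k j).2
      rw [h] at h1
      exact Finset.disjoint_left.1 (hdisj k k' hkk) h1 (e k' j').2
    subst hk
    obtain rfl : j = j' := (e k).injective (Subtype.ext h)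
    rfl
  have hsumA : ∀ (k) (v : Fin (N + 1) → V3),
      ∑ j, ‖v (e k j)‖ ^ 2 = ∑ i ∈ cellSet ℓ z₀ (y k), ‖v i‖ ^ 2 := fun k v => by
    rw [← Finset.sum_coe_sort (cellSet ℓ z₀ (y k))]
    exact Fintype.sum_equiv (e k) (fun j => ‖v (e k j)‖ ^ 2) (fun i => ‖v i‖ ^ 2) fun j => rfl
  have hsumB : ∀ (k) (v : Fin (N + 1) → V3),
      ∑ j, v (e k j) = ∑ i ∈ cellSet ℓ z₀ (y k), v i := fun k v => by
    rw [← Finset.sum_coe_sort (cellSet ℓ z₀ (y k))]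
    exact Fintype.sum_equiv (e k) (fun j => v (e k j)) (fun i => v i) fun j => rfl
  -- the block integrands (those of `stub_gaussCellMGF` with `n = m k`, `u = u_c`, `θ = θ_c`)
  set F : ∀ k, (Fin (m k + 1) → V3) → ℝ≥0∞ := fun k w => ENNReal.ofReal (Real.exp (γ' *
      ((((∑ i, ‖w i‖ ^ 2) - ‖∑ i, w i‖ ^ 2 / ((m k : ℝ) + 1)) +
          ‖(∑ i, w i) - ((m k : ℝ) + 1) • uc‖ ^ 2 / ((m k : ℝ) + 1)) / (2 * θc) -
        3 * ((m k : ℝ) + 1) / 2 *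
          (1 + Real.log (((∑ i, ‖w i‖ ^ 2) - ‖∑ i, w i‖ ^ 2 / ((m k : ℝ) + 1)) /
            (3 * ((m k : ℝ) + 1) * θc)))))) with hF
  have hFm : ∀ k, Measurable (F k) := fun k => by
    simp only [hF]
    fun_prop
  have hGF : ∀ (k) (v : Fin (N + 1) → V3),
      ENNReal.ofReal (Real.exp (γ' * cellKin uc θc ℓ (zipConfig (q, v)) (y k))) =
        F k (fun j => v (e k j)) := fun k v => by
    simp only [hF, cellKin, hcell v, hcnt v, (hm k).1, zipConfig_apply, hsumA, hsumB, Nat.cast_add,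
      Nat.cast_one]
  calc ∫⁻ v, ∏ k, ENNReal.ofReal (Real.exp (γ' * cellKin uc θc ℓ (zipConfig (q, v)) (y k)))
        ∂(Measure.pi fun _ : Fin (N + 1) => gaussMeasure uc θc)
      = ∫⁻ v, ∏ k, F k (fun j => v (e k j)) ∂(Measure.pi fun _ : Fin (N + 1) => gaussMeasure uc θc) :=
        lintegral_congr fun v => Finset.prod_congr rfl fun k _ => hGF k v
    _ = ∏ k, ∫⁻ w, F k w ∂(Measure.pi fun _ : Fin (m k + 1) => gaussMeasure uc θc) :=
        VelocityFactor.lintegral_prod_blocks (gaussMeasure uc θc) (fun k j => (e k j : Fin (N + 1))) hf F hFm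
    _ ≤ ∏ _k : ι, ENNReal.ofReal (max K' 0) :=
        Finset.prod_le_prod' fun k _ => (hK' (m k) (hm k).2 uc θc hθc).trans
          (ENNReal.ofReal_le_ofReal (le_max_left _ _))
    _ = ENNReal.ofReal (max K' 0) ^ Fintype.card ι := by
        rw [Finset.prod_const, Finset.card_univ]

end Barycentric

end Summit.AtomisticToContinuum.HydrodynamicLimit.Theorems.MacroClosureLine

end
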